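import Summits.AtomisticToContinuum.HydrodynamicLimit.Theorems.OneFlightGossipEngineClampedCurrentsDockKineticInstance
import Summits.AtomisticToContinuum.HydrodynamicLimit.Theorems.AntiMazurCoboundariesKineticWindowGronwallProductKineticInstanceCutoff
import Summits.AtomisticToContinuum.HydrodynamicLimit.Theorems.AntiMazurCoboundariesKineticWindowGronwallProductKineticInstanceSplit
import HarnessLib

/-!
# The product kinetic instance (stub `stub_productKineticInstance`, line `rare-band-ladder-dock`,
# crux `KineticWindowGronwall`, stmt-AtomisticToContinuum-9282)

Helper file (`--supports stmt-AtomisticToContinuum-9282`) proving the registered stub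
`stub_productKineticInstance : ProductKineticInstance` (`LocalQuadraticWindowLDFamily → KineticInstanceOut`) of the
lead's skeleton `Cruxes/KineticWindowGronwall/Lines/rare_band_ladder_dock.lean` (v2, §1b/§2): the line's local
PRODUCT node (window exponential moments of `Σᵢ φ(s,xᵢ) g(w̃ᵢ)` in the THERMAL frame `w̃ = (v − u_s(x))/√θ_s(x)`,
`|φ| ≤ 1`, `g` continuous x-independent of quadratic growth and `⊥ 1, w̃, ‖w̃‖²`, amplitude `c⋆` first) gives
VERBATIM the conclusion `KineticInstanceOut` of the landed kinetic instance KC1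
(`ClampedCurrentsDockKineticInstance.stub_kineticInstance`), the only form in which the heart's window clause
consumes its kinetic input.

Proof (docstring of `ProductKineticInstance`):
* CLAMP the slab data to global continuous positive families (`p s = max 0 (min t₁ s)`, toolkit
  `ClampedCurrentsDockKineticInstance.continuous_clamp` & co.), slab bounds `θm ≤ θ ≤ θM`, `|∂ₖuⱼ| ≤ MB`,
  `|∂ₖθ/(2√θ)| ≤ MB`; amplitude `c⋆` from the node along the clamped family;
* THE CUT-OFF IN THE THERMAL FRAME `G_s(x, s') = θ_s(x) G̃(s'/θ_s(x))` with the re-orthogonalised thermal profile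
  `G̃` of `…ProductKineticInstanceCutoff.exists_thermalCutoff` at level `K⋆²/θm` (so `G = s' − 5θ` below `K⋆²`,
  `|G| ≤ θM C` on `s' ≥ 0`, jointly continuous);
* PRODUCT DECOMPOSITION `β · lo = (1/12) Σₘ φₘ(s,x) gₘ(w̃)` over `m ∈ (Fin 3 × Fin 3) ⊕ Fin 3`: traceless thermal
  stresses `gⱼₖ = (c⋆/2)Γⱼₖ`, `φⱼₖ = (24β/c⋆)∂ₖuⱼ`, and flux factors `gₖ = (c⋆/C) w̃ₖG̃(‖w̃‖²)`,
  `φₖ = (12βC/c⋆) ∂ₖθ/(2√θ)`; class facts from the Cutoff file (`stress_orth`, `flux_orth`, growth bounds),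
  `|φₘ| ≤ 1` for `|β| ≤ β₀ = c⋆/(24 C (MB+1))`, pointwise algebra `lo_split`;
* RANK SPLIT (`…ProductKineticInstanceSplit.lintegral_exp_window_avg_le`): linearity of the window functional
  on good orbits, arithmetic-mean Jensen, a.e.-measurability; thresholds `τ₀ := Σₘ τ₀(m)`, `N₀ := Σₘ N₀(m)`;
  read at `s ∈ [0,t₁]` where the clamped families are the data.
-/

noncomputable section

open scoped BigOperators ENNReal Classical
open MeasureTheory Set
open Literature.MathematicalPhysics.KineticTheory Literature.Analysis.FluidPDE Literature.Analysis.FunctionSpaces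

namespace Summit.AtomisticToContinuum.HydrodynamicLimit.Theorems.KineticWindowGronwallProductKineticInstance

open Summit.AtomisticToContinuum.HydrodynamicLimit.Theorems.ClampedCurrentsDockKineticInstance
  (continuous_clamp continuousOn_partialDeriv_slab exists_abs_le_slab exists_pos_le_slab)

/-! ## The statements (verbatim from the registered skeleton, §1 and §1b) -/

/-- The hard-sphere flow of `N+1` spheres at reduced density `σ` on `𝕋³`. -/
abbrev TFlow (σ : ℝ) (N : ℕ) : Type :=
  HardSphereFlow (Torus.geometry (Fin 3)) (hsDiameter σ N) (N + 1)

/-- The orthogonality clause of all kinetic statements of this line (verbatim the clause of `KineticFluxLdDecay`):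
`g ⊥ span{1, w, ‖w‖²}` in `L²(stdGaussian)` — the thermal-frame collision invariants. -/
def Orth (g : V3 → ℝ) : Prop :=
  ∀ (c₀ c₂ : ℝ) (b : V3), ∫ v, g v * (c₀ + inner ℝ b v + c₂ * ‖v‖ ^ 2) ∂(ProbabilityTheory.stdGaussian V3) = 0

/-- **THE DOCKING NODE OF THIS LINE: local quadratic-class window LD in PRODUCT FORM along families.** For jointly
continuous one-parameter families of positive profiles `s ↦ (a_s, θ_s, u_s)` on `[0, t₁]` obeying the `η₀`-activity-ratio
packing guard (the guard of TwoClocks' `KineticWindowLDUniform` / the heart's `KineticCurrentsWindowLDFamily`), at reduced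
density parameter `σ`, there is ONE amplitude `c⋆ > 0` (after `σ` and the family, BEFORE the flow family and the observable)
such that for every jointly continuous space-time weight `|φ| ≤ 1` and every continuous thermal-frame profile `g`,
`|g w| ≤ c⋆(1 + ‖w‖²)`, `g ⊥ span(1, w, ‖w‖²)` under the standard Gaussian: `∀ ε ∃ τ₀ ∀ τ ≥ τ₀ ∃ N₀ ∀ N ≥ N₀ ∀ s ∈ [0,t₁]`,
`∫ exp(Σᵢ w_N⁻¹∫₀^{w_N} φ(s, xᵢ(r)) g((vᵢ(r) − u_s(xᵢ(r)))/√θ_s(xᵢ(r))) dr) dλ^N_s ≤ e^{ε(N+1)}`, `w_N = τ(N+1)^{-1/3}`,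
`λ^N_s = localGibbsLaw σ a_s u_s θ_s N (Φ N)`. WHY THIS SHAPE: (a) product form in the local THERMAL frame is what a bounded
PRODUCT-class hypothesis can reach (the ladder is rank-one by rank-one; a general continuous radial profile `G(x,·)` has
unbounded nuclear rank) and it suffices for the heart, whose kinetic members are finite sums of such products with
x-INDEPENDENT `g` — the traceless thermal stress `w̃ⱼw̃ₖ − δⱼₖ‖w̃‖²/3` (rank ≤ 5) and the re-orthogonalised low heat-flux
cut-off `w̃ⱼ G̃(‖w̃‖²)` with `G̃(r) = (r − 5)χ(r) + c̃ψ(r)`, `c̃` a CONSTANT in the thermal frame (rank 3; its complement vanishes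
for `‖w̃‖ ≤ K̃`, i.e. below the lab threshold `K⋆ = K̃√θ_min`, as `CoherentSuprathermalContentVanishesW` requires of its weight
`R(s,x,·)`); finite sums enter the heart through Hölder at amplitude `c⋆/rank`; (b) amplitude-first and `s`-innermost is the
family-uniform typing an entropy clock along a time-dependent reference CAN consume (UNIFORMITY finding 9133/14680-c2; at
fixed density the functional/frame directions are uniform for free by the PROVED Baire theorem 16625-S3a (kernel-checked, landing kit), so the only
non-trivial uniformity asked here beyond the pointwise global node is the DENSITY BAND, X3); (c) `∃ τ₀ ∀ τ ≥ τ₀` so that all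
channels of the ledger run on one window (upgrade 16625-S3x at equilibrium, proved; pattern = landed WindowSubadditivity p103614). Conjecture-grade (open-problem): it
contains the pointwise local node restricted to product members. -/
def LocalQuadraticWindowLDFamily : Prop :=
  ∃ η₀ : ℝ, 0 < η₀ ∧ ∀ (t₁ : ℝ) (a θ₀ : ℝ → T3 → ℝ) (u₀ : ℝ → T3 → V3),
    Continuous (Function.uncurry a) → Continuous (Function.uncurry θ₀) → Continuous (Function.uncurry u₀) →
    (∀ s x, 0 < a s x) → (∀ s x, 0 < θ₀ s x) →
    ∀ σ : ℝ, 0 < σ → (∀ s ∈ Set.Icc 0 t₁, σ ^ 3 * (⨆ x, a s x) ≤ η₀ * ∫ x, a s x) →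
    ∃ cstar : ℝ, 0 < cstar ∧
    ∀ Φ : (N : ℕ) → TFlow σ N,
    ∀ (φ : ℝ → T3 → ℝ) (g : V3 → ℝ), Continuous (Function.uncurry φ) → Continuous g →
      (∀ s x, |φ s x| ≤ 1) → (∀ w, |g w| ≤ cstar * (1 + ‖w‖ ^ 2)) → Orth g →
      ∀ ε : ℝ, 0 < ε → ∃ τ₀ : ℝ, 0 < τ₀ ∧ ∀ τ : ℝ, τ₀ ≤ τ → ∃ N₀ : ℕ, ∀ N : ℕ, N₀ ≤ N →
      ∀ s ∈ Set.Icc 0 t₁,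
        ∫⁻ z, ENNReal.ofReal (Real.exp (∑ i : Fin (N + 1),
            (τ * ((N : ℝ) + 1) ^ (-(1 / 3 : ℝ)))⁻¹ *
              ∫ r in (0 : ℝ)..(τ * ((N : ℝ) + 1) ^ (-(1 / 3 : ℝ))),
                φ s ((Φ N).flow r z i).1 *
                  g ((Real.sqrt (θ₀ s ((Φ N).flow r z i).1))⁻¹ •
                    (((Φ N).flow r z i).2 - u₀ s ((Φ N).flow r z i).1))))
          ∂(localGibbsLaw σ (a s) (u₀ s) (θ₀ s) N (Φ N)) ≤
        ENNReal.ofReal (Real.exp (ε * ((N : ℝ) + 1)))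

/-- **THE OUTPUT OF THE LANDED KINETIC INSTANCE KC1** — VERBATIM the conclusion of
`Theorems.ClampedCurrentsDockKineticInstance.KineticInstance` (= `KineticCurrentsWindowLDFamily → LoHeatFluxCutoffFamily → THIS`, see the
`rfl` example below): along every reference family `(a, θ, u)` continuous/smooth on the slab `[0,t₁] × 𝕋³` obeying the `ηK` packing guard,
for every suprathermal threshold `K⋆` there is a continuous bounded radial profile `G` equal to `s' − 5θ` below `K⋆²` such that the window
exponential moment of the traceless-thermal-stress + re-orthogonalised low heat-flux member `lo` is `≤ e^{ε(N+1)}` for `|β| ≤ β₀`,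
`τ ≥ τ₀`, `N ≥ N₀`, uniformly in `s ∈ [0,t₁]`. This is the ONLY form in which the heart's window clause consumes its kinetic input. -/
def KineticInstanceOut : Prop :=
  ∃ ηK : ℝ, 0 < ηK ∧ ∀ (t₁ : ℝ) (a θ : ℝ → T3 → ℝ) (u : ℝ → T3 → V3), 0 ≤ t₁ →
    ContinuousOn (Function.uncurry a) (Set.Icc 0 t₁ ×ˢ Set.univ) → (∀ s ∈ Set.Icc 0 t₁, ∀ x, 0 < a s x) →
    Torus.IsSmoothSpaceTimeOn (Set.Icc 0 t₁) θ → Torus.IsSmoothSpaceTimeOn (Set.Icc 0 t₁) u →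
    (∀ s ∈ Set.Icc 0 t₁, ∀ x, 0 < θ s x) →
    ∀ σ : ℝ, 0 < σ → (∀ s ∈ Set.Icc 0 t₁, σ ^ 3 * (⨆ x, a s x) ≤ ηK * ∫ x, a s x) →
    ∀ Φ : (N : ℕ) → HardSphereFlow (Torus.geometry (Fin 3)) (hsDiameter σ N) (N + 1),
    ∀ Kstar : ℝ, 0 < Kstar →
    ∃ G : ℝ → T3 × ℝ → ℝ, ContinuousOn (Function.uncurry G) (Set.Icc 0 t₁ ×ˢ Set.univ) ∧
      (∃ C : ℝ, ∀ s ∈ Set.Icc 0 t₁, ∀ y : T3 × ℝ, 0 ≤ y.2 → |G s y| ≤ C) ∧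
      (∀ s ∈ Set.Icc 0 t₁, ∀ (x : T3) (s' : ℝ), s' ≤ Kstar ^ 2 → G s (x, s') = s' - 5 * θ s x) ∧
      ∃ β₀ : ℝ, 0 < β₀ ∧ ∀ β : ℝ, |β| ≤ β₀ → ∀ ε : ℝ, 0 < ε → ∃ τ₀ : ℝ, 0 < τ₀ ∧ ∀ τ : ℝ, τ₀ ≤ τ →
      ∃ N₀ : ℕ, ∀ N : ℕ, N₀ ≤ N → ∀ s ∈ Set.Icc 0 t₁,
        (let lo := fun (s : ℝ) (y : T3 × V3) =>
           (θ s y.1)⁻¹ * ∑ j : Fin 3, ∑ k : Fin 3,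
               ((y.2 - u s y.1) j * (y.2 - u s y.1) k - (if j = k then ‖y.2 - u s y.1‖ ^ 2 / 3 else 0)) *
                 Torus.partialDeriv k (fun x => u s x j) y.1 +
             (∑ k : Fin 3, Torus.partialDeriv k (θ s) y.1 / (2 * (θ s y.1) ^ 2) * (y.2 - u s y.1) k) *
               G s (y.1, ‖y.2 - u s y.1‖ ^ 2)
         ∫⁻ z, ENNReal.ofReal (Real.exp (β * ∑ i : Fin (N + 1),
             (τ * ((N : ℝ) + 1) ^ (-(1 / 3 : ℝ)))⁻¹ *
               ∫ r in (0 : ℝ)..(τ * ((N : ℝ) + 1) ^ (-(1 / 3 : ℝ))), lo s ((Φ N).flow r z i)))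
           ∂(localGibbsLaw σ (a s) (u s) (θ s) N (Φ N)) ≤
         ENNReal.ofReal (Real.exp (ε * ((N : ℝ) + 1))))

/-- Sanity (v2): `KineticInstanceOut` IS the conclusion of the landed KC1. -/
example : Theorems.ClampedCurrentsDockKineticInstance.KineticInstance =
    (Theorems.ClampedCurrentsDockKineticInstance.KineticCurrentsWindowLDFamily →
      Theorems.ClampedCurrentsDockKineticInstance.LoHeatFluxCutoffFamily → KineticInstanceOut) := rfl

/-- **THE PRODUCT KINETIC INSTANCE**: the line's local product node gives KC1's output. Proof plan: clamp the slab family to a global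
continuous positive family (`ClampedCurrentsDockKineticInstance.continuous_clamp`, `p s = max 0 (min t₁ s)`); choose the cut-off IN THE
THERMAL FRAME, `G s (x, s') := θ_s(x) · G̃(s'/θ_s(x))`, `G̃(r) = (r − 5)χ(r) + c̃ ψ(r)` with `χ = 1` on `[0, K⋆²/θ_min]`, `ψ` a bump beyond,
`c̃` the constant making `∫ ‖w‖² G̃(‖w‖²) dγ = 0` (so each `wₖ G̃(‖w‖²)` is `Orth`); then
`lo = Σ_{j,k} ∂ₖuⱼ · (w̃ⱼw̃ₖ − δⱼₖ‖w̃‖²/3) + Σₖ (∂ₖθ/(2√θ)) · w̃ₖ G̃(‖w̃‖²)`, `w̃ = (v − u)/√θ` — twelve thermal-frame PRODUCTS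
`φₘ(s,x) gₘ(w̃)` with `gₘ` x-independent, continuous, `Orth`, `|gₘ| ≤ c⋆(1 + ‖w̃‖²)` after normalisation and `φₘ` continuous,
`|12 β φₘ| ≤ 1` for `|β| ≤ β₀ := c⋆/(12 B)` (`B` a slab bound of the coefficients); generalized Hölder
`ENNReal.lintegral_prod_norm_pow_le` over the twelve window functionals (each split off on good orbits), each bounded by the node at
`ε`; thresholds `τ₀ := max`, `N₀ := max`. -/
def ProductKineticInstance : Prop :=
  LocalQuadraticWindowLDFamily → KineticInstanceOut

/-! ## The stub -/

/-- **STUB 4a `stub_productKineticInstance`** (line rare-band-ladder-dock, crux stmt-AtomisticToContinuum-9282): the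
product node gives the landed kinetic instance's output — thermal-frame cut-off, product decomposition of KC1's
class member into twelve thermal-frame products, rank split by Jensen over the twelve window functionals (module
docstring). [folklore] -/
theorem stub_productKineticInstance : ProductKineticInstance := by
  rintro ⟨η₀, hη₀, hQ⟩
  refine ⟨η₀, hη₀, ?_⟩
  intro t₁ a θ u ht₁ hac hapos hθ hu hθpos σ hσ hguard Φ Kstar hKstar
  /- (i) the clamp `p s = max 0 (min t₁ s)` and the slab toolkit -/
  obtain ⟨p, hp⟩ : ∃ p : ℝ → ℝ, p = fun s => max 0 (min t₁ s) := ⟨_, rfl⟩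
  have hpc : Continuous p := by
    rw [hp]; exact continuous_const.max (continuous_const.min continuous_id)
  have hpm : ∀ s, p s ∈ Icc 0 t₁ := fun s => by
    rw [hp]; exact ⟨le_max_left _ _, max_le ht₁ (min_le_left _ _)⟩
  have hpid : ∀ s ∈ Icc 0 t₁, p s = s := fun s hs => by
    rw [hp]; show max 0 (min t₁ s) = s; rw [min_eq_right hs.2, max_eq_right hs.1]
  have hθc0 : ContinuousOn (Function.uncurry θ) (Icc 0 t₁ ×ˢ univ) :=
    Torus.continuousOn_uncurry_of_continuousOn_stLift hθ.continuousOn_stLift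
  have huc0 : ContinuousOn (Function.uncurry u) (Icc 0 t₁ ×ˢ univ) :=
    Torus.continuousOn_uncurry_of_continuousOn_stLift hu.continuousOn_stLift
  have hDθ0 : ∀ k : Fin 3, ContinuousOn
      (Function.uncurry fun s x => Torus.partialDeriv k (θ s) x) (Icc 0 t₁ ×ˢ univ) :=
    fun k => continuousOn_partialDeriv_slab ht₁ hθ k
  have hDu0 : ∀ j k : Fin 3, ContinuousOn
      (Function.uncurry fun s x => Torus.partialDeriv k (fun y => u s y j) x) (Icc 0 t₁ ×ˢ univ) :=
    fun j k => continuousOn_partialDeriv_slab ht₁ (hu.apply j) k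
  obtain ⟨θm, hθm0, hθm⟩ := exists_pos_le_slab ht₁ hθc0 hθpos
  obtain ⟨θM, hθM⟩ := exists_abs_le_slab hθc0
  have hθM0 : 0 ≤ θM := (abs_nonneg _).trans (hθM 0 ⟨le_rfl, ht₁⟩ 0)
  -- the flux coefficient `E_k = ∂_kθ/(2√θ)` on the slab
  have hE0 : ∀ k : Fin 3, ContinuousOn
      (Function.uncurry fun s x => Torus.partialDeriv k (θ s) x / (2 * Real.sqrt (θ s x)))
      (Icc 0 t₁ ×ˢ univ) := fun k => by
    have h2 : ContinuousOn (fun q : ℝ × T3 => 2 * Real.sqrt (θ q.1 q.2)) (Icc 0 t₁ ×ˢ univ) :=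
      continuousOn_const.mul (Real.continuous_sqrt.comp_continuousOn hθc0)
    exact (hDθ0 k).div h2 fun q hq =>
      (mul_pos two_pos (Real.sqrt_pos.2 (hθpos q.1 (mem_prod.1 hq).1 q.2))).ne'
  -- ONE bound `MB` for the coefficients `∂ₖuⱼ`, `∂ₖθ/(2√θ)` on the slab
  choose Mu hMu using fun j k : Fin 3 => exists_abs_le_slab (hDu0 j k)
  choose Me hMe using fun k : Fin 3 =>
    exists_abs_le_slab (f := fun s x => Torus.partialDeriv k (θ s) x / (2 * Real.sqrt (θ s x))) (hE0 k)
  obtain ⟨MB, hMB0, hMu', hMe'⟩ : ∃ MB : ℝ, 0 ≤ MB ∧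
      (∀ j k, ∀ s ∈ Icc 0 t₁, ∀ x, |Torus.partialDeriv k (fun y => u s y j) x| ≤ MB) ∧
      (∀ k, ∀ s ∈ Icc 0 t₁, ∀ x, |Torus.partialDeriv k (θ s) x / (2 * Real.sqrt (θ s x))| ≤ MB) := by
    refine ⟨(∑ j, ∑ k, |Mu j k|) + ∑ k, |Me k|, by positivity, fun j k s hs x => ?_, fun k s hs x => ?_⟩
    · have h1 : |Mu j k| ≤ ∑ k, |Mu j k| :=
        Finset.single_le_sum (fun i _ => abs_nonneg (Mu j i)) (Finset.mem_univ k)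
      have h2 : ∑ k, |Mu j k| ≤ ∑ j, ∑ k, |Mu j k| :=
        Finset.single_le_sum (f := fun j => ∑ k, |Mu j k|)
          (fun i _ => Finset.sum_nonneg fun k _ => abs_nonneg (Mu i k)) (Finset.mem_univ j)
      have h3 : 0 ≤ ∑ k, |Me k| := by positivity
      linarith [hMu j k s hs x, le_abs_self (Mu j k)]
    · have h1 : |Me k| ≤ ∑ k, |Me k| :=
        Finset.single_le_sum (fun i _ => abs_nonneg (Me i)) (Finset.mem_univ k)
      have h2 : 0 ≤ ∑ j, ∑ k, |Mu j k| := by positivity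
      linarith [hMe k s hs x, le_abs_self (Me k)]
  /- (ii) the clamped families (global, jointly continuous, positive) -/
  set θc : ℝ → T3 → ℝ := fun s x => θ (p s) x with hθc_def
  set uc : ℝ → T3 → V3 := fun s x => u (p s) x with huc_def
  set ac : ℝ → T3 → ℝ := fun s x => a (p s) x with hac_def
  have hθc_pos : ∀ s x, 0 < θc s x := fun s x => hθpos (p s) (hpm s) x
  have hac_pos : ∀ s x, 0 < ac s x := fun s x => hapos (p s) (hpm s) x
  have hθm_c : ∀ s x, θm ≤ θc s x := fun s x => hθm (p s) (hpm s) x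
  have hθM_c : ∀ s x, θc s x ≤ θM := fun s x => (abs_le.1 (hθM (p s) (hpm s) x)).2
  have hθc_c : Continuous (Function.uncurry θc) := continuous_clamp hpc hpm hθc0
  have huc_c : Continuous (Function.uncurry uc) := continuous_clamp hpc hpm huc0
  have hac_c : Continuous (Function.uncurry ac) := continuous_clamp hpc hpm hac
  have hθc_c' : Continuous fun q : ℝ × T3 => θc q.1 q.2 := by
    simpa only [Function.uncurry_def] using hθc_c
  have hDu_c : ∀ j k, Continuous fun q : ℝ × T3 => Torus.partialDeriv k (fun y => u (p q.1) y j) q.2 :=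
    fun j k => by simpa only [Function.uncurry_def] using continuous_clamp hpc hpm (hDu0 j k)
  have hE_c : ∀ k, Continuous fun q : ℝ × T3 =>
      Torus.partialDeriv k (θ (p q.1)) q.2 / (2 * Real.sqrt (θ (p q.1) q.2)) :=
    fun k => by simpa only [Function.uncurry_def] using continuous_clamp hpc hpm (hE0 k)
  have hguard_c : ∀ s ∈ Icc 0 t₁, σ ^ 3 * (⨆ x, ac s x) ≤ η₀ * ∫ x, ac s x := fun s hs => by
    simp only [hac_def, hpid s hs]; exact hguard s hs
  /- (iii) the amplitude of the node along the clamped family -/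
  obtain ⟨cstar, hc0, Hc⟩ := hQ t₁ ac θc uc hac_c hθc_c huc_c hac_pos hθc_pos σ hσ hguard_c
  /- (iv) the cut-off in the thermal frame -/
  obtain ⟨Gt, hGtc, ⟨CG, hCG0, hCG⟩, hGtlo, hGtm⟩ :=
    exists_thermalCutoff (L := Kstar ^ 2 / θm) (div_pos (pow_pos hKstar 2) hθm0)
  set G : ℝ → T3 × ℝ → ℝ := fun s y => θc s y.1 * Gt (y.2 / θc s y.1) with hG_def
  have hGc : Continuous (Function.uncurry G) := by
    have h1 : Continuous fun q : ℝ × (T3 × ℝ) => θc q.1 q.2.1 :=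
      hθc_c'.comp (continuous_fst.prodMk (continuous_fst.comp continuous_snd))
    have h2 : Continuous fun q : ℝ × (T3 × ℝ) => Gt (q.2.2 / θc q.1 q.2.1) :=
      hGtc.comp ((continuous_snd.comp continuous_snd).div h1 fun q => (hθc_pos _ _).ne')
    have h3 : Continuous fun q : ℝ × (T3 × ℝ) => θc q.1 q.2.1 * Gt (q.2.2 / θc q.1 q.2.1) := h1.mul h2
    simpa only [hG_def, Function.uncurry_def] using h3
  have hGbd : ∀ (s : ℝ) (y : T3 × ℝ), 0 ≤ y.2 → |G s y| ≤ θM * CG := fun s y hy => by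
    simp only [hG_def]
    rw [abs_mul, abs_of_pos (hθc_pos s y.1)]
    exact mul_le_mul (hθM_c s y.1) (hCG _ (div_nonneg hy (hθc_pos s y.1).le)) (abs_nonneg _) hθM0
  have hGlo : ∀ (s : ℝ) (x : T3) (s' : ℝ), s' ≤ Kstar ^ 2 → G s (x, s') = s' - 5 * θc s x := by
    intro s x s' hs'
    have hθx := hθc_pos s x
    have h1 : s' / θc s x ≤ Kstar ^ 2 / θm := by
      rw [div_le_div_iff₀ hθx hθm0]
      calc s' * θm ≤ Kstar ^ 2 * θm := mul_le_mul_of_nonneg_right hs' hθm0.le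
        _ ≤ Kstar ^ 2 * θc s x := mul_le_mul_of_nonneg_left (hθm_c s x) (sq_nonneg _)
    simp only [hG_def]
    rw [hGtlo _ h1, mul_sub, mul_div_assoc', mul_div_cancel_left₀ _ hθx.ne']
    ring
  /- (v) the twelve thermal-frame products: the x-independent factors `gₘ` -/
  set CG' : ℝ := CG + 1 with hCG'
  have hCG'0 : 0 < CG' := by rw [hCG']; linarith
  have hCG'1 : 1 ≤ CG' := by rw [hCG']; linarith
  have hCG1 : ∀ r, 0 ≤ r → |Gt r| ≤ CG' := fun r hr => (hCG r hr).trans (by rw [hCG']; linarith)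
  obtain ⟨g, hg⟩ : ∃ g : (Fin 3 × Fin 3) ⊕ Fin 3 → V3 → ℝ, g = Sum.elim
      (fun jk w => cstar / 2 * (w jk.1 * w jk.2 - if jk.1 = jk.2 then ‖w‖ ^ 2 / 3 else 0))
      (fun k w => cstar / CG' * (w k * Gt (‖w‖ ^ 2))) := ⟨_, rfl⟩
  have hgc : ∀ m, Continuous (g m) := by
    rintro (⟨j, k⟩ | k)
    · simp only [hg, Sum.elim_inl]; exact continuous_const.mul (continuous_stress j k)
    · simp only [hg, Sum.elim_inr]; fun_prop
  have hgK : ∀ m w, |g m w| ≤ cstar * (1 + ‖w‖ ^ 2) := by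
    rintro (⟨j, k⟩ | k) w
    · simp only [hg, Sum.elim_inl]
      rw [abs_mul, abs_of_pos (half_pos hc0)]
      calc cstar / 2 * |w j * w k - if j = k then ‖w‖ ^ 2 / 3 else 0|
          ≤ cstar / 2 * (2 * (1 + ‖w‖ ^ 2)) :=
            mul_le_mul_of_nonneg_left (abs_stress_le j k w) (half_pos hc0).le
        _ = cstar * (1 + ‖w‖ ^ 2) := by ring
    · simp only [hg, Sum.elim_inr]
      rw [abs_mul, abs_of_pos (div_pos hc0 hCG'0)]
      calc cstar / CG' * |w k * Gt (‖w‖ ^ 2)| ≤ cstar / CG' * (CG' * (1 + ‖w‖ ^ 2)) :=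
            mul_le_mul_of_nonneg_left (abs_flux_le k hCG1 w) (div_pos hc0 hCG'0).le
        _ = cstar * (1 + ‖w‖ ^ 2) := by field_simp
  have hgO : ∀ m, Orth (g m) := by
    rintro (⟨j, k⟩ | k) c₀ c₂ b
    · simp only [hg, Sum.elim_inl]; exact stress_orth j k _ c₀ c₂ b
    · simp only [hg, Sum.elim_inr]; exact flux_orth k _ hGtc hCG hGtm c₀ c₂ b
  /- (vi) the output: `G`, its clauses, `β₀`, and the window bound -/
  refine ⟨G, hGc.continuousOn, ⟨θM * CG, fun s _ y hy => hGbd s y hy⟩, fun s hs x s' hs' => ?_,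
    cstar / (24 * CG' * (MB + 1)), by positivity, fun β hβ ε hε => ?_⟩
  · rw [hGlo s x s' hs']
    simp only [hθc_def, hpid s hs]
  -- the weights `φₘ` at tilt `β`
  have hβ1 : 24 * |β| / cstar * MB ≤ 1 := by
    calc 24 * |β| / cstar * MB ≤ 24 * (cstar / (24 * CG' * (MB + 1))) / cstar * MB := by gcongr
      _ = MB / (CG' * (MB + 1)) := by field_simp
      _ ≤ 1 := by rw [div_le_one (by positivity)]; nlinarith [hCG'1, hMB0]
  have hβ2 : 12 * |β| * CG' / cstar * MB ≤ 1 := by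
    calc 12 * |β| * CG' / cstar * MB ≤ 12 * (cstar / (24 * CG' * (MB + 1))) * CG' / cstar * MB := by gcongr
      _ = MB / (2 * (MB + 1)) := by field_simp; ring
      _ ≤ 1 := by rw [div_le_one (by positivity)]; nlinarith [hMB0]
  obtain ⟨φ, hφ⟩ : ∃ φ : (Fin 3 × Fin 3) ⊕ Fin 3 → ℝ → T3 → ℝ, φ = Sum.elim
      (fun jk s x => 24 * β / cstar * Torus.partialDeriv jk.2 (fun y => u (p s) y jk.1) x)
      (fun k s x => 12 * β * CG' / cstar *
        (Torus.partialDeriv k (θ (p s)) x / (2 * Real.sqrt (θ (p s) x)))) := ⟨_, rfl⟩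
  have hφc : ∀ m, Continuous (Function.uncurry (φ m)) := by
    rintro (⟨j, k⟩ | k)
    · simp only [hφ, Sum.elim_inl, Function.uncurry_def]; exact continuous_const.mul (hDu_c j k)
    · simp only [hφ, Sum.elim_inr, Function.uncurry_def]; exact continuous_const.mul (hE_c k)
  have hφ1 : ∀ m s x, |φ m s x| ≤ 1 := by
    rintro (⟨j, k⟩ | k) s x
    · simp only [hφ, Sum.elim_inl]
      rw [abs_mul, abs_div, abs_mul, abs_of_pos (by norm_num : (0 : ℝ) < 24), abs_of_pos hc0]
      exact (mul_le_mul_of_nonneg_left (hMu' j k (p s) (hpm s) x) (by positivity)).trans hβ1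
    · simp only [hφ, Sum.elim_inr]
      rw [abs_mul, abs_div, abs_mul, abs_mul, abs_of_pos (by norm_num : (0 : ℝ) < 12), abs_of_pos hc0,
        abs_of_pos hCG'0]
      exact (mul_le_mul_of_nonneg_left (hMe' k (p s) (hpm s) x) (by positivity)).trans hβ2
  -- the node for each of the twelve products, at `ε`; common thresholds
  choose τ₀ hτ₀0 hτ using fun m => Hc Φ (φ m) (g m) (hφc m) (hgc m) (hφ1 m) (hgK m) (hgO m) ε hε
  refine ⟨∑ m, τ₀ m, Finset.sum_pos (fun m _ => hτ₀0 m) Finset.univ_nonempty, fun τ hτle => ?_⟩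
  have hτm : ∀ m, τ₀ m ≤ τ := fun m =>
    (Finset.single_le_sum (fun m' _ => (hτ₀0 m').le) (Finset.mem_univ m)).trans hτle
  choose N₀ hN using fun m => hτ m τ (hτm m)
  refine ⟨∑ m, N₀ m, fun N hNle s hs => ?_⟩
  have hNm : ∀ m, N₀ m ≤ N := fun m =>
    (Finset.single_le_sum (fun m' _ => Nat.zero_le (N₀ m')) (Finset.mem_univ m)).trans hNle
  intro lo
  /- (vii) at `s ∈ [0,t₁]`: the product decomposition in the ORIGINAL frame and the rank split -/
  have hθx : ∀ x, 0 < θ s x := hθpos s hs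
  have hθs : Continuous (θ s) := (hθ.isSmooth_slice hs).continuous
  have hus : Continuous (u s) := (hu.isSmooth_slice hs).continuous
  obtain ⟨qm, hqm⟩ : ∃ qm : (Fin 3 × Fin 3) ⊕ Fin 3 → T3 × V3 → ℝ,
      qm = fun m y => φ m s y.1 * g m ((Real.sqrt (θ s y.1))⁻¹ • (y.2 - u s y.1)) := ⟨_, rfl⟩
  have hqmc : ∀ m, Continuous (qm m) := fun m => by
    rw [hqm]
    have h1 : Continuous fun y : T3 × V3 => φ m s y.1 :=
      (Continuous.uncurry_left s (hφc m)).comp continuous_fst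
    have h2 : Continuous fun y : T3 × V3 => (Real.sqrt (θ s y.1))⁻¹ :=
      (Real.continuous_sqrt.comp (hθs.comp continuous_fst)).inv₀ fun y =>
        (Real.sqrt_pos.2 (hθx y.1)).ne'
    have h3 : Continuous fun y : T3 × V3 => y.2 - u s y.1 := continuous_snd.sub (hus.comp continuous_fst)
    exact h1.mul ((hgc m).comp (h2.smul h3))
  have hPgood : (localGibbsLaw σ (a s) (u s) (θ s) N (Φ N)) (Φ N).goodᶜ = 0 :=
    (withDensity_absolutelyContinuous _ _ : localGibbsLaw σ (a s) (u s) (θ s) N (Φ N) ≪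
      liouville (Torus.geometry (Fin 3)) (N + 1) (hsDiameter σ N)) (Φ N).measure_compl_good
  have hB : ∀ m, ∫⁻ z, ENNReal.ofReal (Real.exp (∑ i : Fin (N + 1),
      (τ * ((N : ℝ) + 1) ^ (-(1 / 3 : ℝ)))⁻¹ *
        ∫ r in (0 : ℝ)..(τ * ((N : ℝ) + 1) ^ (-(1 / 3 : ℝ))), qm m ((Φ N).flow r z i)))
      ∂(localGibbsLaw σ (a s) (u s) (θ s) N (Φ N)) ≤ ENNReal.ofReal (Real.exp (ε * ((N : ℝ) + 1))) := by
    intro m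
    have h := hN m N (hNm m) s hs
    simp only [hθc_def, huc_def, hac_def, hpid s hs] at h
    simpa only [hqm] using h
  have hcard : (Fintype.card ((Fin 3 × Fin 3) ⊕ Fin 3) : ℝ) = 12 := by
    norm_num [Fintype.card_sum, Fintype.card_prod]
  have hsplit : ∀ y : T3 × V3,
      β * lo s y = (Fintype.card ((Fin 3 × Fin 3) ⊕ Fin 3) : ℝ)⁻¹ * ∑ m, qm m y := by
    rintro ⟨x, v⟩
    have key := lo_split (Real.sqrt_pos.2 (hθx x)) hc0.ne' hCG'0.ne' β
      (fun j k => Torus.partialDeriv k (fun y => u s y j) x) (fun k => Torus.partialDeriv k (θ s) x) Gt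
      (v - u s x)
    rw [Real.mul_self_sqrt (hθx x).le] at key
    simpa only [lo, hqm, hφ, hg, Fintype.sum_sum_type, Fintype.sum_prod_type, Sum.elim_inl, Sum.elim_inr,
      hG_def, hθc_def, hpid s hs, hcard] using key
  exact lintegral_exp_window_avg_le (Φ N) hPgood (lo s) hqmc β hsplit _ hB

end Summit.AtomisticToContinuum.HydrodynamicLimit.Theorems.KineticWindowGronwallProductKineticInstance

end
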